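import Literature.AnabelianGeometry.SemiGraphs.ProSigmaSurfaceTypeInvariance
import Mathlib.GroupTheory.Abelianization.Defs
import Mathlib.GroupTheory.NoncommPiCoprod
import Mathlib.Algebra.BigOperators.Fin
import HarnessLib

/-!
# The abelianisation of a punctured surface group with a cusp: `Γ_{g,r+1}^{ab} ≅ ℤ^{2g} × ℤ^{r}`, named basis

Topic `Literature/GroupTheory/CombinatorialGroupTheory`; theorems only.  For the punctured surface group
`Γ_{g,r+1} = ⟨a₁, b₁, …, a_g, b_g, c₀, …, c_r ∣ [a₁,b₁]⋯[a_g,b_g]·c₀⋯c_r⟩` (`PuncturedSurfaceGroup g (r+1)`)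
the abelianisation is free abelian on the classes of `a_i, b_i` (`i < g`) and of the FIRST `r` cusps
`c_0, …, c_{r-1}`, the class of the last cusp being `c̄_r = −(c̄_0 + ⋯ + c̄_{r-1})` (the relator reads
`Σ_j c̄_j = 0` in the abelianisation):

* `nonempty_mulEquiv_abelianization` — an isomorphism
  `Φ : Γ_{g,r+1}^{ab} ≃* ((Fin g × Bool) ⊕ Fin r → Multiplicative ℤ)` with `Φ(ā_i) = e_{(i,0)}`,
  `Φ(b̄_i) = e_{(i,1)}`, `Φ(c̄_j) = e_j` (`j < r`) and `Φ(c̄_r) = (∏_j e_j)⁻¹`.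

The homomorphism is defined on the presentation (it kills the relator, whose image in a commutative group
is the product of the cusp images, `PuncturedSurfaceGroup.lift_relator_eq_prod`); its inverse is
`e_x ↦ x̄`, and the two composites are the identity on generators.  Used for [CombGC] Rmk. 1.3.1 (rank of
the cusp part `M^cusp` of `M_G = Π_G^{ab}` at genuine smooth curves: the cusp classes span the direct summand
`ℤ^r` complementary to the handle classes).  No free basis of `Γ_{g,r+1}` is used.
[cite: MochizukiCombGC2007, Rmk 1.3.1 p.10] [cite: ZieschangVogtColdewey1980, 4.14]
-/

namespace Literature.GroupTheory.CombinatorialGroupTheory.PuncturedSurfaceGroup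

open Multiplicative

variable {g r : ℕ}

/-- In `Γ_{g,r}^{ab}` the cusp classes multiply to `1`: `∏_j c̄_j = 1` (the relator
`[a₁,b₁]⋯[a_g,b_g]c₁⋯c_r = 1` read in the abelianisation). [cite: ZieschangVogtColdewey1980, 4.14] -/
theorem prod_abelianization_of_c_eq_one :
    ∏ j : Fin r, Abelianization.of (c (g := g) j) = 1 := by
  have h := lift_relator_eq_prod (g := g) (r := r)
    (fun s => Abelianization.of (PresentedGroup.of (rels := {relator g r}) s))
  have hlift : FreeGroup.lift (fun s => Abelianization.of (PresentedGroup.of (rels := {relator g r}) s)) =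
      (Abelianization.of).comp (PresentedGroup.mk {relator g r}) :=
    FreeGroup.ext_hom _ _ fun s => by rw [FreeGroup.lift_apply_of]; rfl
  rw [hlift, MonoidHom.comp_apply, PresentedGroup.one_of_mem (Set.mem_singleton _), map_one] at h
  exact h.symm

/-- **`Γ_{g,r+1}^{ab} ≅ ℤ^{(Fin g × Bool) ⊕ Fin r}` with the named basis**: `ā_i ↦ e_{(i,0)}`,
`b̄_i ↦ e_{(i,1)}`, `c̄_j ↦ e_j` for the first `r` cusps, and the last cusp class to `(∏_j e_j)⁻¹`.
[cite: ZieschangVogtColdewey1980, 4.14] -/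
theorem nonempty_mulEquiv_abelianization (g r : ℕ) :
    ∃ Φ : Abelianization (PuncturedSurfaceGroup g (r + 1)) ≃* (((Fin g × Bool) ⊕ Fin r) → Multiplicative ℤ),
      (∀ ib : Fin g × Bool,
        Φ (Abelianization.of (PresentedGroup.of (Sum.inl ib))) = Pi.mulSingle (Sum.inl ib) (ofAdd 1)) ∧
      (∀ j : Fin r, Φ (Abelianization.of (c (g := g) (Fin.castSucc j))) = Pi.mulSingle (Sum.inr j) (ofAdd 1)) ∧
      Φ (Abelianization.of (c (g := g) (Fin.last r))) = (∏ j : Fin r, Pi.mulSingle (Sum.inr j) (ofAdd 1))⁻¹ := by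
  classical
  -- (1) the hom on the presentation
  let fc : Fin (r + 1) → (((Fin g × Bool) ⊕ Fin r) → Multiplicative ℤ) :=
    Fin.lastCases (∏ j : Fin r, Pi.mulSingle (Sum.inr j) (ofAdd 1))⁻¹
      (fun j => Pi.mulSingle (Sum.inr j) (ofAdd 1))
  have hfc_cs : ∀ j : Fin r, fc (Fin.castSucc j) = Pi.mulSingle (Sum.inr j) (ofAdd 1) := fun j => by
    simp only [fc, Fin.lastCases_castSucc]
  have hfc_last : fc (Fin.last r) = (∏ j : Fin r, Pi.mulSingle (Sum.inr j) (ofAdd 1))⁻¹ := by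
    simp only [fc, Fin.lastCases_last]
  let f : puncturedSurfaceGen g (r + 1) → (((Fin g × Bool) ⊕ Fin r) → Multiplicative ℤ) :=
    Sum.elim (fun ib => Pi.mulSingle (Sum.inl ib) (ofAdd 1)) fc
  have hf : ∀ w ∈ ({relator g (r + 1)} : Set (FreeGroup (puncturedSurfaceGen g (r + 1)))),
      FreeGroup.lift f w = 1 := by
    intro w hw
    rw [Set.mem_singleton_iff.mp hw, lift_relator_eq_prod]
    change ∏ j : Fin (r + 1), fc j = 1
    rw [Fin.prod_univ_castSucc, hfc_last]
    simp only [hfc_cs, mul_inv_cancel]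
  let φ : PuncturedSurfaceGroup g (r + 1) →* (((Fin g × Bool) ⊕ Fin r) → Multiplicative ℤ) :=
    PresentedGroup.toGroup hf
  have hφa : ∀ ib, φ (PresentedGroup.of (Sum.inl ib)) = Pi.mulSingle (Sum.inl ib) (ofAdd 1) :=
    fun ib => PresentedGroup.toGroup.of hf
  have hφc : ∀ j : Fin (r + 1), φ (c (g := g) j) = fc j := fun j => PresentedGroup.toGroup.of hf
  let Φ : Abelianization (PuncturedSurfaceGroup g (r + 1)) →* (((Fin g × Bool) ⊕ Fin r) → Multiplicative ℤ) :=
    Abelianization.lift φ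
  -- (2) the inverse
  let q : ((Fin g × Bool) ⊕ Fin r) → Abelianization (PuncturedSurfaceGroup g (r + 1)) :=
    Sum.elim (fun ib => Abelianization.of (PresentedGroup.of (Sum.inl ib)))
      (fun j => Abelianization.of (c (g := g) (Fin.castSucc j)))
  let Ψ : (((Fin g × Bool) ⊕ Fin r) → Multiplicative ℤ) →* Abelianization (PuncturedSurfaceGroup g (r + 1)) :=
    MonoidHom.noncommPiCoprod (fun x => zpowersHom _ (q x)) (fun _ _ _ x y => Commute.all _ _)
  have hΨ : ∀ x, Ψ (Pi.mulSingle x (ofAdd 1)) = q x := fun x => by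
    rw [MonoidHom.noncommPiCoprod_mulSingle, zpowersHom_apply, toAdd_ofAdd, zpow_one]
  -- (3) mutually inverse
  have h1 : Φ.comp Ψ = MonoidHom.id _ := by
    refine MonoidHom.functions_ext _ _ _ fun x n => ?_
    suffices h : (Φ.comp Ψ).comp (MonoidHom.mulSingle (fun _ : (Fin g × Bool) ⊕ Fin r => Multiplicative ℤ) x) =
        (MonoidHom.id (((Fin g × Bool) ⊕ Fin r) → Multiplicative ℤ)).comp
          (MonoidHom.mulSingle (fun _ : (Fin g × Bool) ⊕ Fin r => Multiplicative ℤ) x) from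
      DFunLike.congr_fun h n
    refine MonoidHom.ext_mint ?_
    change Φ (Ψ (Pi.mulSingle x (ofAdd 1))) = Pi.mulSingle x (ofAdd 1)
    rw [hΨ]
    rcases x with ib | j
    · change Abelianization.lift φ (Abelianization.of _) = _
      rw [Abelianization.lift_apply_of, hφa]
    · change Abelianization.lift φ (Abelianization.of _) = _
      rw [Abelianization.lift_apply_of, hφc, hfc_cs]
  have hlast : Abelianization.of (c (g := g) (Fin.last r)) =
      (∏ j : Fin r, Abelianization.of (c (g := g) (Fin.castSucc j)))⁻¹ := by
    have h := prod_abelianization_of_c_eq_one (g := g) (r := r + 1)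
    rw [Fin.prod_univ_castSucc] at h
    exact eq_inv_of_mul_eq_one_right h
  have h2 : Ψ.comp Φ = MonoidHom.id _ := by
    refine Abelianization.hom_ext _ _ (PresentedGroup.ext fun s => ?_)
    change Ψ (Abelianization.lift φ (Abelianization.of (PresentedGroup.of s))) =
      Abelianization.of (PresentedGroup.of s)
    rw [Abelianization.lift_apply_of]
    rcases s with ib | j
    · rw [hφa, hΨ]; rfl
    · change Ψ (φ (c j)) = Abelianization.of (c j)
      rw [hφc]
      induction j using Fin.lastCases with
      | last =>
        rw [hfc_last, map_inv, map_prod, hlast]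
        simp only [hΨ]
        rfl
      | cast j => rw [hfc_cs, hΨ]; rfl
  have hΦ : ∀ x, Φ (Abelianization.of x) = φ x := fun x => Abelianization.lift_apply_of φ x
  refine ⟨MonoidHom.toMulEquiv Φ Ψ h2 h1, fun ib => ?_, fun j => ?_, ?_⟩
  · rw [MonoidHom.toMulEquiv_apply, hΦ, hφa]
  · rw [MonoidHom.toMulEquiv_apply, hΦ, hφc, hfc_cs]
  · rw [MonoidHom.toMulEquiv_apply, hΦ, hφc, hfc_last]

end Literature.GroupTheory.CombinatorialGroupTheory.PuncturedSurfaceGroup
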